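/-
Copyright: the b2b-balaban T⁴-continuum CRUX team, row NE7b, leaf prover `t4-ne7b-formalise-leaf-06` (gen 145), on the refuter's
PRICING-NE7b v69 κ-ne7bref-g66-1 («suggested kernel object `shiftedGaussianMoment_eq`») and leaf-01 g78's `GaussianRankLocalMomentShift`
(«the converse holds by the exact formula — not proved here»). Project licence.
-/
import Summits.QuantumFields.BalabanUV.T4Continuum.Spine.NE7b.GaussianShiftedFibre
import Summits.QuantumFields.BalabanUV.T4Continuum.Spine.NE7b.GaussianDeterminant

/-!
# THE SHIFTED GAUSSIAN MOMENT IN CLOSED FORM, AND THE NECESSITY OF THE INDUCED-MEAN ENERGY: no bound uniform in the exterior exists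
# (row NE7b, node U5c; kernel theorems of real analysis — the tightness side of residual (R1″))

Cell `pub-balaban`, sub-cell `t4`, spine estimate NE7b (`T4WeightBudget.RelWeightBound`; the cell's OWN estimate — NOT PRINTED in
[Bałaban 1983–89], NOT PROVED).  Crux-route MODEL work under `Spine/NE7b/` (coordinator ruling e34b3e0c item (2)); NOTHING of
Bałaban's is named or asserted; no `T4Continuum/Support` leaf typed; no `def`, no `structure`, no `[cite:]`; zero `sorry`.

WHY.  The OWNER's `…GaussianShiftedFibre.shiftedMoment_le(_of_inducedMean_le)` and leaf-01's `…GaussianRankLocalMomentShift.integral_exp_qf_shift_le`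
bound the shifted Gaussian moment `∫ e^{(u−m)ᵀQ(u−m)} e^{−uᵀSu} du` from ABOVE by `e^{(1+ε⁻¹)·mᵀQm}·(determinant factor)·∫ e^{−uᵀSu}`;
both display the induced-mean energy `mᵀQm` (residual (R1″)) and leaf-01's docstring notes «the converse holds by the exact formula — not
proved here».  THIS FILE proves the converse side, [folklore]: §1 the exact translation of the UNRESTRICTED shifted moment (the OWNER's
`shifted_integral_eq_translated` applied to the Gaussian `S − Q` with exterior term `Qm`) — `∫ e^{(u−m)ᵀQ(u−m)} e^{−uᵀSu} = e^{mᵀQm}·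
e^{m′ᵀ(S−Q)m′}·∫ e^{−uᵀ(S−Q)u}`, `m′ = (S−Q)⁻¹Qm` — and, with the OWNER's `GaussianDeterminant.integral_exp_neg_qf_eq`, the CLOSED FORM
`= e^{mᵀQm + m′ᵀ(S−Q)m′}·(Πᵢ√π)·(√det(S−Q))⁻¹` (refuter κ-ne7bref-g66-1's suggested `shiftedGaussianMoment_eq`); §2 the LOWER BOUND
**`shiftedMoment_ge`**: `e^{mᵀQm}·∫ e^{−uᵀSu} ≤ ∫ e^{(u−m)ᵀQ(u−m)} e^{−uᵀSu}` — the exterior's sacrificed action is a NECESSARY cost,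
letter for letter the `δ·mᵀBm` of the upper bounds up to Young's `(1+ε⁻¹)`; §3 the REFUTED STRENGTHENING **`not_exists_uniform_shift_bound`**:
if `Q` has a direction of positive energy (`wᵀQw > 0`) there is NO constant `C` with `∫ e^{(u−m)ᵀQ(u−m)} e^{−uᵀSu} ≤ C·∫ e^{−uᵀSu}` for all
exteriors `m` — β-uniformity of the (R1′) fibre bound FAILS without the displayed small-field control of the exterior (`hB₀` ∕ `hκ` in
`…GaussianShiftedFibreMoment`, the OWNER's `hB`): the residual (R1″) is REAL, not an artefact of the Young split.

WHAT IS PROVED ([folklore]; the OWNER's files BY NAME + `Real.add_one_le_exp`):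
* §1 `qf_shift_expand` (pointwise `(u−m)ᵀQ(u−m) − uᵀSu = mᵀQm − (uᵀ(S−Q)u + 2uᵀ(Qm))` for symmetric `Q`), **`shiftedGaussianMoment_eq_translated`**,
  **`shiftedGaussianMoment_eq`** (closed form with `det (S − Q)`).
* §2 **`shiftedMoment_ge`** (`S − Q` positive definite, `Q` positive semidefinite).
* §3 **`not_exists_uniform_shift_bound`**.

NOT HERE (honest): the matching UPPER closed-form bound `m′ᵀ(S−Q)m′ ≤ (δ∕(1−δ))·mᵀQm` under `Q ≤ δS` (a Loewner-order step; the OWNER's ∕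
leaf-01's Young bounds serve instead); restricted versions (a characteristic function `F₁` only LOWERS the numerator — the necessity statement
is about the unrestricted model); anything of Bałaban's.  BY-NAME EFFECT ON THE WALL: NONE (a tightness lemma).  NE7b NOT PRINTED ∕ NOT PROVED;
spine PROVED 0∕9; rung (B)+1 on a FINITE torus — NOT infinite volume, NOT the mass gap, NOT Clay.
HONEST DEPENDENCY: continuum YM on T⁴ ⇐ BetaPertH ∧ nine spine estimates (0/9 proved); BetaPertH ⇐ (D1) ∧ (D4) ∧ CAP+tail;
G-an2-4 gates asym, D1 and NE2/3/4.
-/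

set_option autoImplicit false

open Matrix Finset MeasureTheory Real
open Summit.QuantumFields.BalabanUV.T4Continuum.NE7b.QuadFormSimDiag (qf_nonneg_of_posSemidef)
open Summit.QuantumFields.BalabanUV.T4Continuum.NE7b.GaussianShiftedFibre (shifted_integral_eq_translated)
open Summit.QuantumFields.BalabanUV.T4Continuum.NE7b.GaussianDeterminant (integral_exp_neg_qf_eq)

namespace Summit.QuantumFields.BalabanUV.T4Continuum.NE7b.GaussianShiftedFibreSharp

variable {n : Type} [Fintype n] [DecidableEq n]

/-! ## §1 The unrestricted shifted moment, exactly -/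

omit [DecidableEq n] in
/-- **EXPANDING THE SHIFTED SACRIFICED FORM AGAINST THE GAUSSIAN**: for symmetric `Q`,
`(u−m)ᵀQ(u−m) − uᵀSu = mᵀQm − (uᵀ(S−Q)u + 2·uᵀ(Qm))`. [folklore] -/
theorem qf_shift_expand {Q : Matrix n n ℝ} (hQ : Q.IsSymm) (S : Matrix n n ℝ) (u m : n → ℝ) :
    (u - m) ⬝ᵥ (Q *ᵥ (u - m)) - u ⬝ᵥ (S *ᵥ u) = m ⬝ᵥ (Q *ᵥ m) - (u ⬝ᵥ ((S - Q) *ᵥ u) + 2 * (u ⬝ᵥ (Q *ᵥ m))) := by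
  have hsym : m ⬝ᵥ (Q *ᵥ u) = u ⬝ᵥ (Q *ᵥ m) := by
    rw [dotProduct_mulVec u Q m, ← mulVec_transpose, hQ.eq, dotProduct_comm]
  rw [mulVec_sub, sub_dotProduct, dotProduct_sub, dotProduct_sub, hsym, sub_mulVec, dotProduct_sub]
  ring

/-- **THE UNRESTRICTED SHIFTED MOMENT, TRANSLATED EXACTLY.**  For `Q` positive semidefinite and `S − Q` positive definite,
`∫ e^{(u−m)ᵀQ(u−m)}·e^{−uᵀSu} du = e^{mᵀQm} · (e^{m′ᵀ(S−Q)m′} · ∫ e^{−uᵀ(S−Q)u} du)` with `m′ = (S−Q)⁻¹(Qm)` — the OWNER's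
`…GaussianShiftedFibre.shifted_integral_eq_translated` on the Gaussian `S − Q` with exterior term `Qm` and trivial weight. [folklore] -/
theorem shiftedGaussianMoment_eq_translated {S Q : Matrix n n ℝ} (hQ : Q.PosSemidef) (hSQ : (S - Q).PosDef) (m : n → ℝ) :
    ∫ u, exp ((u - m) ⬝ᵥ (Q *ᵥ (u - m))) * exp (-(u ⬝ᵥ (S *ᵥ u))) =
      exp (m ⬝ᵥ (Q *ᵥ m)) *
        (exp (((S - Q)⁻¹ *ᵥ (Q *ᵥ m)) ⬝ᵥ ((S - Q) *ᵥ ((S - Q)⁻¹ *ᵥ (Q *ᵥ m)))) *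
          ∫ u, exp (-(u ⬝ᵥ ((S - Q) *ᵥ u)))) := by
  have hQs : Q.IsSymm := by
    have h := hQ.1
    rw [IsHermitian, conjTranspose_eq_transpose_of_trivial] at h
    exact h
  have hSs : (S - Q).IsSymm := by
    have h := hSQ.1
    rw [IsHermitian, conjTranspose_eq_transpose_of_trivial] at h
    exact h
  have hdet : IsUnit (S - Q).det := isUnit_iff_ne_zero.2 hSQ.det_pos.ne'
  -- pointwise: `e^{(u−m)ᵀQ(u−m)} e^{−uᵀSu} = e^{mᵀQm} · (1 · e^{−(uᵀ(S−Q)u + 2uᵀ(Qm))})`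
  have e : ∀ u, exp ((u - m) ⬝ᵥ (Q *ᵥ (u - m))) * exp (-(u ⬝ᵥ (S *ᵥ u))) =
      exp (m ⬝ᵥ (Q *ᵥ m)) * ((fun _ : n → ℝ => (1 : ℝ)) u * exp (-(u ⬝ᵥ ((S - Q) *ᵥ u) + 2 * (u ⬝ᵥ (Q *ᵥ m))))) := by
    intro u
    rw [one_mul, ← exp_add, ← exp_add]
    congr 1
    have h := qf_shift_expand hQs S u m
    linarith
  rw [integral_congr_ae (Filter.Eventually.of_forall e), integral_const_mul,
    shifted_integral_eq_translated hSs hdet (Q *ᵥ m) (fun _ => (1 : ℝ))]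
  simp only [one_mul]

/-- **THE SHIFTED GAUSSIAN MOMENT IN CLOSED FORM** (refuter κ-ne7bref-g66-1's suggested `shiftedGaussianMoment_eq`): with the OWNER's
Gaussian determinant formula, `∫ e^{(u−m)ᵀQ(u−m)}·e^{−uᵀSu} du = e^{mᵀQm}·e^{m′ᵀ(S−Q)m′}·((Πᵢ√π)·(√det(S−Q))⁻¹)`, `m′ = (S−Q)⁻¹(Qm)`.
[folklore] -/
theorem shiftedGaussianMoment_eq {S Q : Matrix n n ℝ} (hQ : Q.PosSemidef) (hSQ : (S - Q).PosDef) (m : n → ℝ) :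
    ∫ u, exp ((u - m) ⬝ᵥ (Q *ᵥ (u - m))) * exp (-(u ⬝ᵥ (S *ᵥ u))) =
      exp (m ⬝ᵥ (Q *ᵥ m)) *
        (exp (((S - Q)⁻¹ *ᵥ (Q *ᵥ m)) ⬝ᵥ ((S - Q) *ᵥ ((S - Q)⁻¹ *ᵥ (Q *ᵥ m)))) *
          ((∏ _i : n, √π) * (√((S - Q).det))⁻¹)) := by
  rw [shiftedGaussianMoment_eq_translated hQ hSQ m, integral_exp_neg_qf_eq hSQ]

/-! ## §2 The lower bound: the exterior's sacrificed action is a necessary cost -/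

/-- **THE SHIFT PRICE IS AT LEAST `e^{mᵀQm}`.**  For `S`, `S − Q` positive definite and `Q` positive semidefinite:
`e^{mᵀQm} · ∫ e^{−uᵀSu} du ≤ ∫ e^{(u−m)ᵀQ(u−m)}·e^{−uᵀSu} du` — the converse of the OWNER's ∕ leaf-01's Young upper bounds
(`e^{(1+ε⁻¹)mᵀQm}·…`): the induced-mean energy enters the shifted moment NECESSARILY, so a bound uniform in the exterior needs the
exterior's energy bounded (residual (R1″) is real). [folklore] -/
theorem shiftedMoment_ge {S Q : Matrix n n ℝ} (hS : S.PosDef) (hQ : Q.PosSemidef) (hSQ : (S - Q).PosDef) (m : n → ℝ) :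
    exp (m ⬝ᵥ (Q *ᵥ m)) * ∫ u, exp (-(u ⬝ᵥ (S *ᵥ u))) ≤
      ∫ u, exp ((u - m) ⬝ᵥ (Q *ᵥ (u - m))) * exp (-(u ⬝ᵥ (S *ᵥ u))) := by
  rw [shiftedGaussianMoment_eq_translated hQ hSQ m]
  refine mul_le_mul_of_nonneg_left ?_ (exp_pos _).le
  -- `∫ e^{−uᵀSu} ≤ ∫ e^{−uᵀ(S−Q)u}` pointwise (`uᵀQu ≥ 0`), and `1 ≤ e^{m′ᵀ(S−Q)m′}`
  have hmono : ∫ u, exp (-(u ⬝ᵥ (S *ᵥ u))) ≤ ∫ u, exp (-(u ⬝ᵥ ((S - Q) *ᵥ u))) := by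
    refine integral_mono (GaussianRestrictedMoment.integrable_exp_neg_qf hS)
      (GaussianRestrictedMoment.integrable_exp_neg_qf hSQ) fun u => ?_
    refine exp_le_exp.2 (neg_le_neg ?_)
    rw [sub_mulVec, dotProduct_sub]
    linarith [qf_nonneg_of_posSemidef hQ u]
  have h1 : (1 : ℝ) ≤ exp (((S - Q)⁻¹ *ᵥ (Q *ᵥ m)) ⬝ᵥ ((S - Q) *ᵥ ((S - Q)⁻¹ *ᵥ (Q *ᵥ m)))) :=
    one_le_exp (qf_nonneg_of_posSemidef hSQ.posSemidef _)
  have hI : 0 ≤ ∫ u, exp (-(u ⬝ᵥ ((S - Q) *ᵥ u))) := integral_nonneg fun u => (exp_pos _).le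
  calc ∫ u, exp (-(u ⬝ᵥ (S *ᵥ u))) ≤ ∫ u, exp (-(u ⬝ᵥ ((S - Q) *ᵥ u))) := hmono
    _ = 1 * ∫ u, exp (-(u ⬝ᵥ ((S - Q) *ᵥ u))) := (one_mul _).symm
    _ ≤ _ := mul_le_mul_of_nonneg_right h1 hI

/-! ## §3 The refuted strengthening: no bound uniform in the exterior -/

/-- **NO EXTERIOR-UNIFORM BOUND EXISTS.**  If `Q` has a direction `w` of positive energy, `wᵀQw > 0` (with `S`, `S − Q` positive
definite, `Q` positive semidefinite), then there is NO constant `C` with `∫ e^{(u−m)ᵀQ(u−m)}·e^{−uᵀSu} ≤ C·∫ e^{−uᵀSu}` for every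
exterior `m`: along `m = t·w` the left side is `≥ e^{t²·wᵀQw}·∫ e^{−uᵀSu}` (§2), unbounded in `t`.  So the displayed small-field control
of the exterior in the (R1′)∕(R1″) fibre bounds (`hB` ∕ `hB₀` ∕ `hκ`) cannot be dropped. [folklore] -/
theorem not_exists_uniform_shift_bound {S Q : Matrix n n ℝ} (hS : S.PosDef) (hQ : Q.PosSemidef) (hSQ : (S - Q).PosDef)
    {w : n → ℝ} (hw : 0 < w ⬝ᵥ (Q *ᵥ w)) :
    ¬ ∃ C : ℝ, ∀ m : n → ℝ,
      ∫ u, exp ((u - m) ⬝ᵥ (Q *ᵥ (u - m))) * exp (-(u ⬝ᵥ (S *ᵥ u))) ≤ C * ∫ u, exp (-(u ⬝ᵥ (S *ᵥ u))) := by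
  rintro ⟨C, hC⟩
  have hI : 0 < ∫ u, exp (-(u ⬝ᵥ (S *ᵥ u))) := GaussianDominatedMoment.integral_exp_neg_qf_pos hS
  -- along `m = t • w` the shifted moment is at least `e^{t²·wᵀQw}` times the free mass
  have key : ∀ t : ℝ, exp (t ^ 2 * (w ⬝ᵥ (Q *ᵥ w))) ≤ C := by
    intro t
    have h := (shiftedMoment_ge hS hQ hSQ (t • w)).trans (hC (t • w))
    have e : (t • w) ⬝ᵥ (Q *ᵥ (t • w)) = t ^ 2 * (w ⬝ᵥ (Q *ᵥ w)) := by
      rw [mulVec_smul, smul_dotProduct, dotProduct_smul, smul_eq_mul, smul_eq_mul]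
      ring
    rw [e] at h
    exact le_of_mul_le_mul_right h hI
  -- choose `t` with `t²·wᵀQw = |C| + 1`: then `|C| + 2 ≤ e^{|C|+1} ≤ C ≤ |C|`, absurd
  set t : ℝ := √((|C| + 1) / (w ⬝ᵥ (Q *ᵥ w))) with ht
  have ht2 : t ^ 2 * (w ⬝ᵥ (Q *ᵥ w)) = |C| + 1 := by
    rw [ht, Real.sq_sqrt (div_nonneg (by positivity) hw.le), div_mul_cancel₀ _ hw.ne']
  have h1 := key t
  rw [ht2] at h1
  have h2 : |C| + 1 + 1 ≤ exp (|C| + 1) := Real.add_one_le_exp _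
  linarith [le_abs_self C]

end Summit.QuantumFields.BalabanUV.T4Continuum.NE7b.GaussianShiftedFibreSharp
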